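import Summits.Ventures.PercRepro.C026EdgeMono
import Summits.Ventures.PercRepro.C026HubParallelAny
import Summits.Ventures.PercRepro.C026ProdCFCorollary4

/-!
# THEOREM R: CONJECTURE EM ⟹ CONJECTURE MONO and EM ⟹ (CF), unconditionally (p5, gen 17)

The hub factor `HubFactor` of C026EdgeMono is discharged by p6's `slackCF_eq_of_hubAB`
(C026HubParallelAny — mine-3's (R0): `Δ_CF(H) = (2^k + 2^l − 1)·Δ_CF(H − u)` when every edge at
the non-mark `u` goes to `a` or to `b`), the degenerate marking `a = b` by `slackCF_self`. Hence
mine-3's THEOREM R (INBOX 6152, `proofs/MINE3-EDGEMONO.md` §4) in the tree: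

* **`slackCF_nonneg_of_edgeMono`** — (R2): CONJECTURE EM gives `0 ≤ Δ_CF` on every marked
  multigraph;
* **`mono_of_edgeMono`** — (R1): CONJECTURE EM implies CONJECTURE MONO (ROW C-031);
  `slackCF_del_le_of_edgeMono` — under EM, deleting ANY non-mark `u ≠ c` never increases `Δ_CF`;
* `slackCF_hub_mul_le_of_edgeMono` — (R1) with mine-3's explicit factor:
  `(2^k + 2^l − 1)·Δ_CF(H − u) ≤ Δ_CF(H)` for `u` joined to `a` by `k` and to `b` by `l` edges
  (the engine's «ratio exactly 2 at a pendant `u`, ≥ 3 at a common neighbour»);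
* **`c026_of_edgeMono`** — CONJECTURE EM for every marking gives C-026 at every edge weight on
  every marked multigraph (Corollary 4's bridge `c026_of_slackCF_all`);
* `EdgeMonoA`, `monoA_of_edgeMonoA`, `slackCF_nonneg_of_edgeMonoA` — mine-3's all-markings forms.
-/

universe u v

namespace PercRepro

open Finset

namespace MultiGraph

section EdgeMonoMain

variable {V : Type u}

/-- `1 ≤ 2^k + 2^l − 1` in `ℤ`. -/
theorem one_le_two_pow_add_two_pow_sub_one (k l : ℕ) : (1 : ℤ) ≤ 2 ^ k + 2 ^ l - 1 := by
  have hk : (1 : ℤ) ≤ 2 ^ k := one_le_pow₀ (by norm_num)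
  have hl : (1 : ℤ) ≤ 2 ^ l := one_le_pow₀ (by norm_num)
  linarith

open Classical in
/-- **The hub factor holds** (mine-3's (R0), p6's `slackCF_eq_of_hubAB`): `m = 2^k + 2^l − 1 ≥ 1`;
when `a = b` both slacks vanish (`slackCF_self`) and `m = 1`. -/
theorem hubFactor (a b c : V) : HubFactor.{u, v} a b c := by
  intro E _ H u hua hub huc h
  by_cases hab : a = b
  · subst hab
    exact ⟨1, le_rfl, by rw [slackCF_self, slackCF_self, mul_zero]⟩
  · exact ⟨_, one_le_two_pow_add_two_pow_sub_one _ _, slackCF_eq_of_hubAB H hua hub huc hab h⟩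

/-- **THEOREM R (R2)** (mine-3, INBOX 6152): CONJECTURE EM — deleting an off-mark edge never
increases `Δ_CF` — gives C-026's (CF) form `0 ≤ Δ_CF` on every marked multigraph on `V` with
marks `a, b, c`. -/
theorem slackCF_nonneg_of_edgeMono {a b c : V} (hE : EdgeMono.{u, v} a b c) {E : Type v}
    [Fintype E] (G : MultiGraph V E) : 0 ≤ G.slackCF a b c :=
  slackCF_nonneg_of_edgeMono_of_hubFactor (hubFactor a b c) hE G

/-- **THEOREM R (R1)** (mine-3, INBOX 6152): CONJECTURE EM implies CONJECTURE MONO (ROW C-031) —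
deleting a non-mark neighbour of `a` or `b` never increases `Δ_CF`. -/
theorem mono_of_edgeMono {a b c : V} (hE : EdgeMono.{u, v} a b c) : Mono.{u, v} a b c :=
  mono_of_edgeMono_of_hubFactor (hubFactor a b c) hE

open Classical in
/-- Under CONJECTURE EM, deleting ANY vertex `u ∉ {a, b, c}` never increases `Δ_CF`. -/
theorem slackCF_del_le_of_edgeMono {a b c : V} (hE : EdgeMono.{u, v} a b c) {E : Type v}
    [Fintype E] (H : MultiGraph V E) {u : V} (hua : u ≠ a) (hub : u ≠ b) (huc : u ≠ c) :
    (H.part (H.delSide u) true).slackCF a b c ≤ H.slackCF a b c :=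
  slackCF_del_le_of_edgeMono_of_hubFactor (hubFactor a b c) hE H hua hub huc

open Classical in
/-- The stripped graph keeps every edge joining `u` to a mark `x ≠ u` (it drops only the off-mark
edges at `u`): the `u–x` counts of `H′` and of `H` agree. -/
theorem card_edgeAt_keepHub {E : Type v} [Fintype E] (H : MultiGraph V E) (u a b x : V)
    (hx : x = a ∨ x = b) :
    (univ.filter fun e : {e // H.keepHub u a b e = true} =>
        (H.part (H.keepHub u a b) true).EdgeAt e u ∧ (H.part (H.keepHub u a b) true).EdgeAt e x).card =
      (univ.filter fun e => H.EdgeAt e u ∧ H.EdgeAt e x).card := by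
  refine Finset.card_bij (fun e _ => e.1) ?_ ?_ ?_
  · intro e he
    simp only [Finset.mem_filter, Finset.mem_univ, true_and] at he ⊢
    exact he
  · intro e _ e' _ h
    exact Subtype.ext h
  · intro e he
    simp only [Finset.mem_filter, Finset.mem_univ, true_and] at he
    have hk : H.keepHub u a b e = true := by
      unfold keepHub
      rw [decide_eq_true_iff]
      intro _
      rcases hx with rfl | rfl
      · exact Or.inl he.2
      · exact Or.inr he.2
    refine ⟨⟨e, hk⟩, ?_, rfl⟩
    simp only [Finset.mem_filter, Finset.mem_univ, true_and]
    exact he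

open Classical in
/-- **THEOREM R (R1) with mine-3's explicit factor**: under CONJECTURE EM, for a non-mark `u`
joined to `a` by `k` edges and to `b` by `l` edges (and to anything else), `(2^k + 2^l − 1)·Δ_CF(H − u)
≤ Δ_CF(H)` — «ratio exactly 2 at a pendant `u`, ≥ 3 at a common neighbour». -/
theorem slackCF_hub_mul_le_of_edgeMono {a b c : V} (hE : EdgeMono.{u, v} a b c) {E : Type v}
    [Fintype E] (H : MultiGraph V E) {u : V} (hua : u ≠ a) (hub : u ≠ b) (huc : u ≠ c)
    (hab : a ≠ b) :
    (2 ^ (univ.filter fun e => H.EdgeAt e u ∧ H.EdgeAt e a).card +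
        2 ^ (univ.filter fun e => H.EdgeAt e u ∧ H.EdgeAt e b).card - 1) *
      (H.part (H.delSide u) true).slackCF a b c ≤ H.slackCF a b c := by
  have h1 : (H.part (H.keepHub u a b) true).slackCF a b c ≤ H.slackCF a b c :=
    slackCF_part_le_of_edgeMono hE H _ (fun e he => ((keepHub_eq_false_iff H u a b e).1 he).2)
  have h2 := slackCF_eq_of_hubAB (H.part (H.keepHub u a b) true) hua hub huc hab
    (part_keepHub_hub H u a b)
  rw [slackCF_relabel (isRelabel_hubDel H u a b), card_edgeAt_keepHub H u a b a (Or.inl rfl),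
    card_edgeAt_keepHub H u a b b (Or.inr rfl)] at h2
  rw [← h2]
  exact h1

/-- **CONJECTURE EM ⟹ C-026 at every edge weight** (Corollary 4's bridge): if deleting an
off-mark edge never increases `Δ_CF` for every marking of every finite multigraph, then the every-`p`
C-026 inequality holds on every marked multigraph. -/
theorem c026_of_edgeMono (hE : ∀ (V' : Type u) (a b c : V'), EdgeMono.{u, v} a b c) {E : Type v}
    [Fintype E] [DecidableEq E] (G : MultiGraph V E) (a b c : V) (p : E → ℝ) (hp : IsProb p) :
    (G.law3 p a b c 0 + G.law3 p a b c 1) * (G.law3 p a b c 1 + G.law3 p a b c 4) ≤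
      G.law3 p a b c 1 + G.law3 p a b c 2 + G.law3 p a b c 3 :=
  c026_of_slackCF_all (fun V' _ _ H a b c => slackCF_nonneg_of_edgeMono (hE V' a b c) H) G a b c p hp

/-- **CONJECTURE EM for every marking of `V`** (mine-3's form: every marked multigraph on `V`). -/
def EdgeMonoA (V : Type u) : Prop := ∀ a b c : V, EdgeMono.{u, v} a b c

/-- mine-3's form of EM gives mine-3's form of MONO (`MonoA`). -/
theorem monoA_of_edgeMonoA (h : EdgeMonoA.{u, v} V) : MonoA.{u, v} V :=
  fun _ _ H a b c _ hua hub huc _ => slackCF_del_le_of_edgeMono (h a b c) H hua hub huc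

/-- mine-3's form of EM gives (CF) for every marking. -/
theorem slackCF_nonneg_of_edgeMonoA (h : EdgeMonoA.{u, v} V) {E : Type v} [Fintype E]
    (G : MultiGraph V E) (a b c : V) : 0 ≤ G.slackCF a b c :=
  slackCF_nonneg_of_edgeMono (h a b c) G

end EdgeMonoMain

end MultiGraph

end PercRepro
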